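import Mathlib
import Summits.ValiantsHypothesis.ValiantsHypothesis.Theorems.DivisionGapDefs
import Literature.Computability.AlgebraicComplexity.ValiantClassesProofs
import Literature.Computability.AlgebraicComplexity.PermanentIrreducible
import Literature.Computability.AlgebraicComplexity.ArithCircuitProofs

/-!
# `DivisionGap.PerCofactorDegreeReduction` (stmt-ValiantsHypothesis-15046), line `Sketch_ideator4`
(idea intrinsic-member-descent): the member descent (stub `stub_memberDescent`)

For a cell set `G ⊆ [n] × [n]` and a multiplier `h` over `ℝ≥0`, the MEMBER substitution
`x_e ↦ x_e` (`e ∈ G`), `x_e ↦ 0` (`e ∉ G`) is a Valiant projection (variables to variables or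
constants), hence free for the tree's fan-in-two `complexity` (`complexity_le_of_isProjection`).
It is a ring map sending

* `per_n = Σ_σ x^{μ_σ}` to the face permanent `per_G = facePer G` (a permutation monomial
  survives iff all its cells `(σ i, i)` lie in `G`), and
* `h = Σ_u coeff_u h · x^u` to its `G`-member part `Σ_{supp u ⊆ G} coeff_u h · x^u` (a monomial
  survives iff its support lies in `G`; otherwise some factor is `0 ^ k`, `k ≥ 1`).

Hence `L(per_G · h|_G) ≤ L(per_n · h)`. [folklore]
-/

noncomputable section

-- `Summit.ValiantsHypothesis.ValiantsHypothesis.…` is the tree's mandated single-conjunct layout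
-- (Sub = Summit), so the duplicated namespace component is intended.
set_option linter.dupNamespace false

open MvPolynomial Literature.Computability.AlgebraicComplexity
open Summit.ValiantsHypothesis.ValiantsHypothesis.Theorems.DivisionGapPerDivisionHard (facePer)
open scoped NNReal

namespace Summit.ValiantsHypothesis.ValiantsHypothesis.Theorems.DivisionGap.PerCofactorDegreeReduction.MemberDescent

variable {n : ℕ}

/-! ### The member substitution on monomials -/

/-- A monomial supported inside `G` is fixed by the member substitution
`x_e ↦ x_e` (`e ∈ G`), `x_e ↦ 0` (`e ∉ G`). [folklore] -/
theorem aeval_member_monomial_of_subset (G : Finset (Fin n × Fin n))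
    {u : (Fin n × Fin n) →₀ ℕ} (hu : u.support ⊆ G) (c : ℝ≥0) :
    aeval (fun e => if e ∈ G then (X e : MvPolynomial (Fin n × Fin n) ℝ≥0) else 0)
        (monomial u c) = monomial u c := by
  rw [aeval_monomial, algebraMap_eq, monomial_eq]
  congr 1
  refine Finset.prod_congr rfl fun e he => ?_
  show (if e ∈ G then X e else 0) ^ (u e) = X e ^ (u e)
  rw [if_pos (hu he)]

/-- A monomial NOT supported inside `G` is killed by the member substitution: the factor of a
variable `x_e`, `e ∉ G`, of positive exponent becomes `0`. [folklore] -/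
theorem aeval_member_monomial_of_not_subset (G : Finset (Fin n × Fin n))
    {u : (Fin n × Fin n) →₀ ℕ} (hu : ¬ u.support ⊆ G) (c : ℝ≥0) :
    aeval (fun e => if e ∈ G then (X e : MvPolynomial (Fin n × Fin n) ℝ≥0) else 0)
        (monomial u c) = 0 := by
  obtain ⟨e, heu, heG⟩ := Finset.not_subset.1 hu
  rw [aeval_monomial, Finsupp.prod, Finset.prod_eq_zero heu, mul_zero]
  show (if e ∈ G then X e else 0) ^ (u e) = 0
  rw [if_neg heG, zero_pow (Finsupp.mem_support_iff.1 heu)]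

/-- The member substitution applied to `h`, monomial by monomial: it keeps exactly the monomials
supported inside `G`. [folklore] -/
theorem aeval_member_eq_sum (G : Finset (Fin n × Fin n))
    (h : MvPolynomial (Fin n × Fin n) ℝ≥0) :
    aeval (fun e => if e ∈ G then (X e : MvPolynomial (Fin n × Fin n) ℝ≥0) else 0) h =
      ∑ u ∈ h.support.filter (fun u => u.support ⊆ G), monomial u (coeff u h) := by
  conv_lhs => rw [h.as_sum]
  rw [map_sum, Finset.sum_filter]
  refine Finset.sum_congr rfl fun u _ => ?_
  by_cases hu : u.support ⊆ G
  · rw [if_pos hu, aeval_member_monomial_of_subset G hu]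
  · rw [if_neg hu, aeval_member_monomial_of_not_subset G hu]

/-! ### The member substitution on the permanent -/

/-- The monomial of a permutation `σ` is supported inside `G` iff all the cells `(σ i, i)` lie in
`G`. [folklore] -/
theorem support_permMonomial_subset_iff (G : Finset (Fin n × Fin n)) (σ : Equiv.Perm (Fin n)) :
    (permMonomial σ).support ⊆ G ↔ ∀ i, (σ i, i) ∈ G := by
  constructor
  · intro hσ i
    apply hσ
    rw [Finsupp.mem_support_iff, permMonomial_apply, if_pos rfl]
    exact one_ne_zero
  · rintro hσ ⟨r, c⟩ he
    rw [Finsupp.mem_support_iff, permMonomial_apply] at he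
    by_cases h : σ c = r
    · subst h
      exact hσ c
    · rw [if_neg h] at he
      exact absurd rfl he

/-- The member substitution sends `per_n` to the face permanent `per_G`. [folklore] -/
theorem aeval_member_perPoly (G : Finset (Fin n × Fin n)) :
    aeval (fun e => if e ∈ G then (X e : MvPolynomial (Fin n × Fin n) ℝ≥0) else 0)
        (perPoly (Fin n) ℝ≥0) = facePer G := by
  rw [perPoly_eq_sum_monomial, map_sum, facePer, Finset.sum_filter]
  refine Finset.sum_congr rfl fun σ _ => ?_
  by_cases hσ : ∀ i, (σ i, i) ∈ G
  · rw [if_pos hσ,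
      aeval_member_monomial_of_subset G ((support_permMonomial_subset_iff G σ).2 hσ)]
  · rw [if_neg hσ, aeval_member_monomial_of_not_subset G
      (fun hsub => hσ ((support_permMonomial_subset_iff G σ).1 hsub))]

/-! ### The stub -/

/-- **Member descent (stub `stub_memberDescent` of line `Sketch_ideator4`).**  For every cell set
`G` and every multiplier `h` over `ℝ≥0`, `L(per_G · h|_G) ≤ L(per_n · h)`, where
`per_G = facePer G` is the face permanent and `h|_G = Σ_{supp u ⊆ G} coeff_u h · x^u` the
`G`-member part of `h`: the member substitution `x_e ↦ x_e` (`e ∈ G`), `x_e ↦ 0` (`e ∉ G`) is a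
Valiant projection, hence free (`complexity_le_of_isProjection`), and it is a ring map sending
`per_n` to `per_G` and `h` to `h|_G`. [folklore] -/
theorem stub_memberDescent :
    ∀ (n : ℕ) (h : MvPolynomial (Fin n × Fin n) ℝ≥0) (G : Finset (Fin n × Fin n)),
      complexity (facePer G *
          ∑ u ∈ h.support.filter (fun u => u.support ⊆ G), monomial u (coeff u h)) ≤
        complexity (perPoly (Fin n) ℝ≥0 * h) := by
  intro n h G
  refine complexity_le_of_isProjection ⟨fun e => if e ∈ G then X e else 0, fun e => ?_, ?_⟩
  · by_cases he : e ∈ G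
    · exact Or.inl ⟨e, if_pos he⟩
    · refine Or.inr ⟨0, ?_⟩
      show (if e ∈ G then X e else 0) = C 0
      rw [if_neg he, C_0]
  · rw [map_mul, aeval_member_perPoly, aeval_member_eq_sum]

end Summit.ValiantsHypothesis.ValiantsHypothesis.Theorems.DivisionGap.PerCofactorDegreeReduction.MemberDescent

end
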